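import Mathlib
import Summits.KontsevichZagierPeriods.Zeta5Search.DenomLaw.ThresholdModelCasoratian
import Summits.KontsevichZagierPeriods.Zeta5Search.DenomLaw.ThresholdModelDict

/-!
# ζ(5) search — DENOM-LAW D1: classes of threshold score `4` on the five non-deep «LB-K⁺» digit types are symmetric and off the centre

Cell `pub-zeta5`, track DENOM-LAW (denom-prover-d1 g7, 2026-08-24; K2 piece of ATTEMPT-7 §12).  HONEST FRAMING: systematic search;
MODEL/structure side — elementary order-statistic bookkeeping in the threshold model (`L`, `R`, `n₊`, `n₋` of Part I) on sorted
block coordinates `ρ`; nothing about ζ(5); no γ; no p-adic digit, no linear form, no kernel value; no irrationality claim; records in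
print UNMOVED.

## What is proved (kernel-checked), for sorted `ρ` (`r 0 ≤ … ≤ r 6`):
* mirror identities `L(−u) = R(u)`, `R(−u) = L(u)`, `n₊(−u) = n₋(u)`, `n₋(−u) = n₊(u)`; `score_zero_eq` (the centre class `u = 0`
  scores `2L(0) + 2n₊(0) + 1`, an ODD number); `seven_le_score_self` (the self-mirror class `u = p` scores `≥ 7` when `ρ₆ + ρ₇ ≤ 4p − 2`);
* `fires_aux` — on the representative side `0 < u < p` a class of score `4` with `R ≥ 1` is symmetric (`L = R`, `n₊ = n₋`) unless its
  root type is `(L,R,n₊,n₋) = (3,1,0,0)` or `(2,1,1,0)`;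
* `LRnn_of_score_four_l42 / l32 / l31 / l3 / l2` — on the digit types a=0 λ=(4,2) [pairs (1,5),(2,3),(2,4) low], a=1 λ=(3,2) [block 1
  looped, pairs (1,4),(2,3),(2,4) low], a=2 λ=(3,1) [blocks 1,2 looped, pairs (1,4),(2,3) low], a=3 λ=(3) [blocks 1–3 looped, pair (1,4)
  low], a=4 λ=(2) [blocks 1–4 looped, pair (1,3) low] (1-based block labels; «looped» = `ρ_j ≤ R₀ − p`, i.e. `b_j ≥ p`; «low» =
  `ρ_j + ρ_k < 2p`, i.e. the pair block below `p`) every class `0 < u < p` of score `4` has `L = R` and `n₊ = n₋`;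
* `fires_of_score_four` — hence (mirror + parity at the centre + the self-mirror bound) EVERY class `−p < u ≤ p` of score `4` on these
  types is off the centre and symmetric: `u ≠ 0 ∧ L(u) = R(u) ∧ n₊(u) = n₋(u)` — the firing condition of the orbit credit
  (`OrbitCreditD4.casLBKPlus_ge_of_allfire`).
Numerical companion (model side, exhaustive over all sorted parity-correct `ρ` in the box for `p = 7, 11`, `code/k2/typecheck.py` of the
seat folder): on the five types the minimal score is `4` or `5`, and every class of score `4` fires (582 + 350 + 412 + 350 + 350 classes at `p = 11`, 0 exceptions).
-/

namespace Summit.KontsevichZagierPeriods.Zeta5Search.DenomLaw.ThresholdModel.Rho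

section ScoreFour
variable {p R0 : ℤ} {r : Fin 7 → ℤ}

/-! ### mirror identities and the two special classes -/

/-- `L(−u) = R(u)`. -/
theorem L_neg (p : ℤ) (r : Fin 7 → ℤ) (u : ℤ) : L p r (-u) = R p r u := by
  unfold L R; rw [show -u + p = p - u by ring]

/-- `R(−u) = L(u)`. -/
theorem R_neg (p : ℤ) (r : Fin 7 → ℤ) (u : ℤ) : R p r (-u) = L p r u := by
  unfold L R; rw [show p - -u = u + p by ring]

/-- `n₊(−u) = n₋(u)`. -/
theorem np_neg (p R0 u : ℤ) : np p R0 (-u) = nm p R0 u := by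
  unfold np nm; exact indic_congr (by constructor <;> intro h <;> linarith)

/-- `n₋(−u) = n₊(u)`. -/
theorem nm_neg (p R0 u : ℤ) : nm p R0 (-u) = np p R0 u := by
  unfold np nm; exact indic_congr (by constructor <;> intro h <;> linarith)

/-- **the centre class `u = 0` has ODD score** `2L(0) + 2n₊(0) + 1` (`L(0) = R(0)`, `n₊(0) = n₋(0)`, centre weight `1`). -/
theorem score_zero_eq (p R0 : ℤ) (r : Fin 7 → ℤ) : score p R0 r 0 = 2 * L p r 0 + 2 * np p R0 0 + 1 := by
  have e1 : R p r 0 = L p r 0 := by unfold L R; rw [show p - 0 = 0 + p by ring]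
  have e2 : nm p R0 0 = np p R0 0 := by unfold np nm; exact indic_congr (by constructor <;> intro h <;> linarith)
  unfold score delta centre
  rw [e1, e2, indic_pos (Or.inl rfl)]; ring

/-- **the self-mirror class `u = p` scores at least `7`**: six blocks lie below `2p` (`ρ₆ ≤ ρ₇`, `ρ₆ + ρ₇ ≤ 4p − 2`) and the
centre weight is `1`. -/
theorem seven_le_score_self (hr : Monotone r) (h56 : r 5 + r 6 ≤ 4 * p - 2) (R0 : ℤ) : 7 ≤ score p R0 r p := by
  have m56 : r 5 ≤ r 6 := hr (by decide)
  have e5 : (((5 : Fin 7) : ℕ) : ℤ) = 5 := by decide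
  have L6 := countLt_ge hr 5 (show r 5 < p + p by linarith)
  rw [e5] at L6
  have cR := countLt_nonneg r (p - p)
  have i1 := indic_nonneg (2 * p - R0 ≤ p)
  have i2 := indic_nonneg (p ≤ R0 - 2 * p)
  unfold score delta L R np nm centre
  rw [indic_pos (Or.inr rfl)]
  linarith

/-- **the arithmetic skeleton**: for `0 < u < p` (so `R ≤ L`, `n₋ ≤ n₊`, no centre weight) a class of score `4` with `R ≥ 1` has
`L = R` and `n₊ = n₋` unless `(L, R, n₊, n₋) = (3, 1, 0, 0)` or `(2, 1, 1, 0)`. -/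
theorem fires_aux {u : ℤ} (hu : 0 < u) (hup : u < p) (hsc : score p R0 r u = 4) (hR1 : 1 ≤ R p r u)
    (h31 : ¬ (L p r u = 3 ∧ R p r u = 1 ∧ np p R0 u = 0 ∧ nm p R0 u = 0))
    (h21 : ¬ (L p r u = 2 ∧ R p r u = 1 ∧ np p R0 u = 1 ∧ nm p R0 u = 0)) :
    L p r u = R p r u ∧ np p R0 u = nm p R0 u := by
  have hRL := R_le_L p r hu
  have hnn := nm_le_np p R0 hu
  have i1 := indic_le_one (2 * p - R0 ≤ u)
  have i2 := indic_nonneg (u ≤ R0 - 2 * p)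
  have hc : centre p u = 0 := indic_neg (by rintro (h | h) <;> omega)
  unfold score delta at hsc
  rw [hc] at hsc
  unfold np nm at *
  omega

/-! ### the five digit types (0-based block indices `r 0 ≤ … ≤ r 6`; hypotheses = the few pattern facts actually used) -/

/-- **type a = 0, λ = (4,2)**: pairs `(0,4)`, `(1,2)`, `(1,3)` low.  (`R = 0` would put five blocks below `p + u`; the two bad
root types contradict the low pairs `(1,3)`, `(1,2)`.) -/
theorem LRnn_of_score_four_l42 (hr : Monotone r) (h04 : r 0 + r 4 < 2 * p) (h12 : r 1 + r 2 < 2 * p)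
    (h13 : r 1 + r 3 < 2 * p) {u : ℤ} (hu : 0 < u) (hup : u < p) (hsc : score p R0 r u = 4) :
    L p r u = R p r u ∧ np p R0 u = nm p R0 u := by
  have e1 : (((1 : Fin 7) : ℕ) : ℤ) = 1 := by decide
  have e2 : (((2 : Fin 7) : ℕ) : ℤ) = 2 := by decide
  have e3 : (((3 : Fin 7) : ℕ) : ℤ) = 3 := by decide
  have e4 : (((4 : Fin 7) : ℕ) : ℤ) = 4 := by decide
  have cL := countLt_nonneg r (u + p)
  have cR := countLt_nonneg r (p - u)
  have i1 := indic_nonneg (2 * p - R0 ≤ u)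
  have i2 := indic_nonneg (u ≤ R0 - 2 * p)
  have i3 := indic_nonneg (u = 0 ∨ u = p)
  have hsc' := hsc
  unfold score delta L R np nm centre at hsc'
  have hR1 : 1 ≤ R p r u := by
    by_contra h0
    have hr0 : ¬ r 0 < p - u := fun h => h0 (by have := countLt_ge hr 0 h; simp at this; unfold R; linarith)
    have L5 := countLt_ge hr 4 (show r 4 < u + p by linarith)
    rw [e4] at L5
    linarith
  refine fires_aux hu hup hsc hR1 ?_ ?_
  · rintro ⟨hL, hR, -, -⟩
    unfold L at hL
    unfold R at hR
    have hr1 : ¬ r 1 < p - u := fun h => by have := countLt_ge hr 1 h; rw [e1] at this; linarith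
    have hr3 : ¬ r 3 < u + p := fun h => by have := countLt_ge hr 3 h; rw [e3] at this; linarith
    linarith
  · rintro ⟨hL, hR, -, -⟩
    unfold L at hL
    unfold R at hR
    have hr1 : ¬ r 1 < p - u := fun h => by have := countLt_ge hr 1 h; rw [e1] at this; linarith
    have hr2 : ¬ r 2 < u + p := fun h => by have := countLt_ge hr 2 h; rw [e2] at this; linarith
    linarith

/-- **type a = 1, λ = (3,2)**: block `0` looped (`ρ₁ ≤ R₀ − p`), pairs `(0,3)`, `(1,2)`, `(1,3)` low.  (`R = 0` forces `n₊ = 1` and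
four blocks below `p + u`.) -/
theorem LRnn_of_score_four_l32 (hr : Monotone r) (hl0 : r 0 ≤ R0 - p) (h03 : r 0 + r 3 < 2 * p) (h12 : r 1 + r 2 < 2 * p)
    (h13 : r 1 + r 3 < 2 * p) {u : ℤ} (hu : 0 < u) (hup : u < p) (hsc : score p R0 r u = 4) :
    L p r u = R p r u ∧ np p R0 u = nm p R0 u := by
  have e1 : (((1 : Fin 7) : ℕ) : ℤ) = 1 := by decide
  have e2 : (((2 : Fin 7) : ℕ) : ℤ) = 2 := by decide
  have e3 : (((3 : Fin 7) : ℕ) : ℤ) = 3 := by decide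
  have cL := countLt_nonneg r (u + p)
  have cR := countLt_nonneg r (p - u)
  have i1 := indic_nonneg (2 * p - R0 ≤ u)
  have i2 := indic_nonneg (u ≤ R0 - 2 * p)
  have i3 := indic_nonneg (u = 0 ∨ u = p)
  have hsc' := hsc
  unfold score delta L R np nm centre at hsc'
  have hR1 : 1 ≤ R p r u := by
    by_contra h0
    have hr0 : ¬ r 0 < p - u := fun h => h0 (by have := countLt_ge hr 0 h; simp at this; unfold R; linarith)
    have hn : indic (2 * p - R0 ≤ u) = 1 := indic_pos (by linarith)
    have L4 := countLt_ge hr 3 (show r 3 < u + p by linarith)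
    rw [e3] at L4
    linarith
  refine fires_aux hu hup hsc hR1 ?_ ?_
  · rintro ⟨hL, hR, -, -⟩
    unfold L at hL
    unfold R at hR
    have hr1 : ¬ r 1 < p - u := fun h => by have := countLt_ge hr 1 h; rw [e1] at this; linarith
    have hr3 : ¬ r 3 < u + p := fun h => by have := countLt_ge hr 3 h; rw [e3] at this; linarith
    linarith
  · rintro ⟨hL, hR, -, -⟩
    unfold L at hL
    unfold R at hR
    have hr1 : ¬ r 1 < p - u := fun h => by have := countLt_ge hr 1 h; rw [e1] at this; linarith
    have hr2 : ¬ r 2 < u + p := fun h => by have := countLt_ge hr 2 h; rw [e2] at this; linarith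
    linarith

/-- **type a = 2, λ = (3,1)**: blocks `0, 1` looped (`ρ₂ ≤ R₀ − p`), pairs `(0,3)`, `(1,2)` low.  (`R ≤ 1` forces `n₊ = 1`, killing
`(3,1,0,0)`; `(2,1,1,0)` contradicts the low pair `(1,2)`.) -/
theorem LRnn_of_score_four_l31 (hr : Monotone r) (hl1 : r 1 ≤ R0 - p) (h03 : r 0 + r 3 < 2 * p) (h12 : r 1 + r 2 < 2 * p)
    {u : ℤ} (hu : 0 < u) (hup : u < p) (hsc : score p R0 r u = 4) :
    L p r u = R p r u ∧ np p R0 u = nm p R0 u := by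
  have m01 : r 0 ≤ r 1 := hr (by decide)
  have e1 : (((1 : Fin 7) : ℕ) : ℤ) = 1 := by decide
  have e2 : (((2 : Fin 7) : ℕ) : ℤ) = 2 := by decide
  have e3 : (((3 : Fin 7) : ℕ) : ℤ) = 3 := by decide
  have cL := countLt_nonneg r (u + p)
  have cR := countLt_nonneg r (p - u)
  have i1 := indic_nonneg (2 * p - R0 ≤ u)
  have i2 := indic_nonneg (u ≤ R0 - 2 * p)
  have i3 := indic_nonneg (u = 0 ∨ u = p)
  have hsc' := hsc
  unfold score delta L R np nm centre at hsc'
  have hR1 : 1 ≤ R p r u := by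
    by_contra h0
    have hr0 : ¬ r 0 < p - u := fun h => h0 (by have := countLt_ge hr 0 h; simp at this; unfold R; linarith)
    have hn : indic (2 * p - R0 ≤ u) = 1 := indic_pos (by linarith)
    have L4 := countLt_ge hr 3 (show r 3 < u + p by linarith)
    rw [e3] at L4
    linarith
  refine fires_aux hu hup hsc hR1 ?_ ?_
  · rintro ⟨-, hR, hn, -⟩
    unfold R at hR
    have hr1 : ¬ r 1 < p - u := fun h => by have := countLt_ge hr 1 h; rw [e1] at this; linarith
    have : indic (2 * p - R0 ≤ u) = 1 := indic_pos (by linarith)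
    unfold np at hn
    linarith
  · rintro ⟨hL, hR, -, -⟩
    unfold L at hL
    unfold R at hR
    have hr1 : ¬ r 1 < p - u := fun h => by have := countLt_ge hr 1 h; rw [e1] at this; linarith
    have hr2 : ¬ r 2 < u + p := fun h => by have := countLt_ge hr 2 h; rw [e2] at this; linarith
    linarith

/-- **type a = 3, λ = (3)**: blocks `0, 1, 2` looped (`ρ₃ ≤ R₀ − p`), pair `(0,3)` low.  (`R ≤ 1` forces `n₊ = 1`; in `(2,1,1,0)` the
looped block `2` lies above `p + u`, forcing `n₋ = 1`.) -/
theorem LRnn_of_score_four_l3 (hr : Monotone r) (hl2 : r 2 ≤ R0 - p) (h03 : r 0 + r 3 < 2 * p)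
    {u : ℤ} (hu : 0 < u) (hup : u < p) (hsc : score p R0 r u = 4) :
    L p r u = R p r u ∧ np p R0 u = nm p R0 u := by
  have m01 : r 0 ≤ r 1 := hr (by decide)
  have m12 : r 1 ≤ r 2 := hr (by decide)
  have e1 : (((1 : Fin 7) : ℕ) : ℤ) = 1 := by decide
  have e2 : (((2 : Fin 7) : ℕ) : ℤ) = 2 := by decide
  have e3 : (((3 : Fin 7) : ℕ) : ℤ) = 3 := by decide
  have cL := countLt_nonneg r (u + p)
  have cR := countLt_nonneg r (p - u)
  have i1 := indic_nonneg (2 * p - R0 ≤ u)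
  have i2 := indic_nonneg (u ≤ R0 - 2 * p)
  have i3 := indic_nonneg (u = 0 ∨ u = p)
  have hsc' := hsc
  unfold score delta L R np nm centre at hsc'
  have hR1 : 1 ≤ R p r u := by
    by_contra h0
    have hr0 : ¬ r 0 < p - u := fun h => h0 (by have := countLt_ge hr 0 h; simp at this; unfold R; linarith)
    have hn : indic (2 * p - R0 ≤ u) = 1 := indic_pos (by linarith)
    have L4 := countLt_ge hr 3 (show r 3 < u + p by linarith)
    rw [e3] at L4
    linarith
  refine fires_aux hu hup hsc hR1 ?_ ?_
  · rintro ⟨-, hR, hn, -⟩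
    unfold R at hR
    have hr1 : ¬ r 1 < p - u := fun h => by have := countLt_ge hr 1 h; rw [e1] at this; linarith
    have : indic (2 * p - R0 ≤ u) = 1 := indic_pos (by linarith)
    unfold np at hn
    linarith
  · rintro ⟨hL, -, -, hm⟩
    unfold L at hL
    have hr2 : ¬ r 2 < u + p := fun h => by have := countLt_ge hr 2 h; rw [e2] at this; linarith
    have : indic (u ≤ R0 - 2 * p) = 1 := indic_pos (by linarith)
    unfold nm at hm
    linarith

/-- **type a = 4, λ = (2)**: blocks `0, …, 3` looped (`ρ₄ ≤ R₀ − p`), pair `(0,2)` low.  (`R = 0` forces `n₊ = 1`, three blocks below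
`p + u`, and either a fourth one or `n₋ = 1` from the looped block `3`; the bad root types die as in type `(3)`.) -/
theorem LRnn_of_score_four_l2 (hr : Monotone r) (hl3 : r 3 ≤ R0 - p) (h02 : r 0 + r 2 < 2 * p)
    {u : ℤ} (hu : 0 < u) (hup : u < p) (hsc : score p R0 r u = 4) :
    L p r u = R p r u ∧ np p R0 u = nm p R0 u := by
  have m01 : r 0 ≤ r 1 := hr (by decide)
  have m12 : r 1 ≤ r 2 := hr (by decide)
  have m23 : r 2 ≤ r 3 := hr (by decide)
  have e1 : (((1 : Fin 7) : ℕ) : ℤ) = 1 := by decide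
  have e2 : (((2 : Fin 7) : ℕ) : ℤ) = 2 := by decide
  have e3 : (((3 : Fin 7) : ℕ) : ℤ) = 3 := by decide
  have cL := countLt_nonneg r (u + p)
  have cR := countLt_nonneg r (p - u)
  have i1 := indic_nonneg (2 * p - R0 ≤ u)
  have i2 := indic_nonneg (u ≤ R0 - 2 * p)
  have i3 := indic_nonneg (u = 0 ∨ u = p)
  have hsc' := hsc
  unfold score delta L R np nm centre at hsc'
  have hR1 : 1 ≤ R p r u := by
    by_contra h0
    have hr0 : ¬ r 0 < p - u := fun h => h0 (by have := countLt_ge hr 0 h; simp at this; unfold R; linarith)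
    have hn : indic (2 * p - R0 ≤ u) = 1 := indic_pos (by linarith)
    have L3 := countLt_ge hr 2 (show r 2 < u + p by linarith)
    rw [e2] at L3
    by_cases h3 : r 3 < u + p
    · have L4 := countLt_ge hr 3 h3
      rw [e3] at L4
      linarith
    · have : indic (u ≤ R0 - 2 * p) = 1 := indic_pos (by linarith)
      linarith
  refine fires_aux hu hup hsc hR1 ?_ ?_
  · rintro ⟨-, hR, hn, -⟩
    unfold R at hR
    have hr1 : ¬ r 1 < p - u := fun h => by have := countLt_ge hr 1 h; rw [e1] at this; linarith
    have : indic (2 * p - R0 ≤ u) = 1 := indic_pos (by linarith)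
    unfold np at hn
    linarith
  · rintro ⟨hL, -, -, hm⟩
    unfold L at hL
    have hr2 : ¬ r 2 < u + p := fun h => by have := countLt_ge hr 2 h; rw [e2] at this; linarith
    have : indic (u ≤ R0 - 2 * p) = 1 := indic_pos (by linarith)
    unfold nm at hm
    linarith

/-! ### from the representative side to every class -/

/-- **every class of score `4` fires** once the representative side does: `u = 0` is excluded by parity (`score_zero_eq`),
`u = p` by `seven_le_score_self`, and `u < 0` is the mirror of `−u > 0`. -/
theorem fires_of_score_four (hr : Monotone r) (h56 : r 5 + r 6 ≤ 4 * p - 2)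
    (H : ∀ v, 0 < v → v < p → score p R0 r v = 4 → L p r v = R p r v ∧ np p R0 v = nm p R0 v)
    {u : ℤ} (hu1 : -p < u) (hu2 : u ≤ p) (hsc : score p R0 r u = 4) :
    u ≠ 0 ∧ L p r u = R p r u ∧ np p R0 u = nm p R0 u := by
  have hu0 : u ≠ 0 := by
    rintro rfl
    rw [score_zero_eq] at hsc
    omega
  have hup : u ≠ p := by
    rintro rfl
    have := seven_le_score_self hr h56 R0
    omega
  refine ⟨hu0, ?_⟩
  rcases lt_or_gt_of_ne hu0 with hneg | hpos
  · have hc : centre p u = 0 := indic_neg (by rintro (h | h) <;> omega)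
    have hc' : centre p (-u) = 0 := indic_neg (by rintro (h | h) <;> omega)
    have hsc' : score p R0 r (-u) = 4 := by
      unfold score at hsc ⊢
      rw [delta_neg, hc']
      rw [hc] at hsc
      linarith
    obtain ⟨h1, h2⟩ := H (-u) (by omega) (by omega) hsc'
    rw [L_neg, R_neg] at h1
    rw [np_neg, nm_neg] at h2
    exact ⟨h1.symm, h2.symm⟩
  · exact H u hpos (lt_of_le_of_ne hu2 hup) hsc

end ScoreFour

end Summit.KontsevichZagierPeriods.Zeta5Search.DenomLaw.ThresholdModel.Rho
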